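import Summits.QuantumFields.BalabanUV.T4Continuum.Support.CovariantLineAveragingTower
import Summits.QuantumFields.BalabanUV.T4Continuum.Support.CovariantBlockAveraging

/-!
# T⁴ programme, spine node NE2 (U1a) — BAŁABAN's LINE-AVERAGED COVARIANT VECTOR AVERAGING: the one-step block / line TRANSPORTERS
# BUILT FROM A PER-BOND TOWER, and `LineTransportLaws` FROM PER-BOND LAWS (tier B, leaf-proposed support row B3.a-vec-bond of
# `t4/formal/NE2/LEAVES.md`; the declared open input of row B3.a-vec, one level down)

NE2 formalisation swarm, seat `b2b-balaban-t4-ne2-formalise-leaf-02` (GEN 2).  Row B3.a-vec (`Support/CovariantLinePlanting`,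
`Support/CovariantLineAveraging`, `Support/CovariantLineAveragingTower`) typed the covariant `k`-fold averaging as a COMPOSITE OF ONE-STEP
covariant line-block averagings ([Balaban1985BackgroundPropagators] (3.15) p.393 shape «Q_j(U) = Q(Ū^{(j−1)})⋯Q(U)») with the one-step
BLOCK transporters `T k j x` and LINE transporters `Rl k j t x` as DATA, and proved `AveragingLaws` / the Gram row / the η-rate from the
hypothesis SHAPE `LineTransportLaws T Rl αT αR βs`.  This file goes ONE LEVEL DOWN, to the shape in which node NE3 (U1b) and the regularity
class ([Balaban1985BackgroundPropagators] (3.35)–(3.36)) speak: PER BOND.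
 * §1 list algebra for CONTRACTIONS: `‖Π_b f b‖ ≤ 1`, `‖Π_b f b − Π_b g b‖ ≤ |Γ|·sup_b ‖f b − g b‖`, `‖Π_b f b − 1‖ ≤ |Γ|·sup_b ‖f b − 1‖`;
 * §2 the ONE-STEP BLOCK CONTOUR at two levels `(N, R)`: `bcontour N R M z` = the (1.7) legs from the block corner `R·par z` to `z`
   (`rem z ν₀` bonds in direction `0`, then `rem z ν₁` in direction `1`, …; [Balaban1984PropagatorsI] (1.7) p.18 shape, built from leaf-07's
   `CovariantBlockAveraging.leg`), `length_bcontour_le : |Γ| ≤ d·(R − 1)`; only the LENGTH enters the laws, so every theorem below is stated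
   for an arbitrary one-step contour system `Γ : StepContours L M` with `|Γ j x| ≤ ℓ` (canonical instance `stepContour`, `ℓ = d(L − 1)`);
 * §3 the transporters from a PER-BOND TOWER `U : (k j : ℕ) → idx L M (j+1) → M_o(ℂ)` (depth `k`, step `j`: the bond variables of the
   background that the step-`j` one-step averaging of the depth-`k` composite sees, on the `L^{−(j+1)}` lattice — DATA, trigger c5, no
   dictionary asserted): **`Tb Γ U k j x := Π_{b ∈ Γ j x} U k j b`** (ordered, first bond leftmost — «U(Γ) = Π_i U(x_i, x_{i+1})»,
   [Balaban1985Averaging] (9) p.18 shape; `= CovariantBlockAveraging.transport` read in any colour slot, `Tb_eq_transport`) and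
   **`Rlb U k j t x := Π_{s<t} U k j (x + s e_μ, μ)`** (the straight line of (1.18), `x = (site, μ)`); `Tb Γ 1 = 1`, `Rlb 1 = 1`, hence
   `QcovLine (Tb Γ 1) (Rlb 1) = Bref` (the row's normalisation clause: at `U = 1` the typed operator IS Bałaban's `Q_k ⊗ 1`);
 * §4 the hypothesis SHAPE **`BondTowerLaws U αb βb`** (asserted by nobody): contractions `‖U k j b‖ ≤ 1`; per-bond size
   `‖U k j b − 1‖ ≤ αb·L^{−(j+1)}` (small field in a regular gauge: bond variables within `αb × spacing` of `1`); per-bond TWO-DEPTH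
   consistency `‖U (k+1) j b − U k j b‖ ≤ βb k j` — node NE3's currency AT BOND GRANULARITY (the `j`-fold-averaged backgrounds of depths `k`,
   `k + 1` compared on their common lattice), DISPLAYED; it is NOT derived here from row B6's `LocalRate (bgReadings …)` read-out (that needs the
   nonlinear averaging map `U ↦ Ū`, dictionary territory); and **`lineTransportLaws_of_bonds`**:
   `(∀ j x, |Γ j x| ≤ ℓ) → BondTowerLaws U αb βb → LineTransportLaws L M (Tb Γ U) (Rlb U) (ℓ·αb·L⁻¹) αb (fun k j => (ℓ + L)·βb k j)`;
 * §5 the ENDs of row B3.a-vec BY NAME on these data: `averagingLaws_covariantLine_of_bonds`, `perturbationLaws_covariantLineGram_of_bonds`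
   (THE ONE TARGET SHAPE of LEAVES.md for the summand `c·((Q^U_k)ᴴQ^U_k − Q_kᴴQ_k)`), `towerLimitRate_covariantLineGram_of_bonds`,
   `covariantLineGram_rate_of_bonds` (`t = 1`, `c = a`, threshold DISPLAYED; canonical contours: `hΓ := length_stepContour_le`);
 * §6 WHERE NE3 ENTERS: if the one-step backgrounds of every depth are read from ONE level tower `W` (`U k j := W (j+1)`, DEPTH-INDEPENDENT —
   NOT Bałaban's `U_k(V)`, whose `j`-fold averages depend on the depth `k`), the consistency budget is `0` and the η-rate needs no NE3 input at
   all (`bondTowerLaws_of_levels`, `covariantLineGram_rate_of_levels`): in the line presentation node NE3 enters SOLELY through the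
   depth-dependence of the one-step backgrounds.
RELATION TO THE OTHER B3 ROWS (no identification asserted): the (α) instance of record for ROOT B (REFEREE c8) is leaf-07's nested-contour
`Qcov`/`QcovLev` with leaf-06's `NestedContourTransport(Contour)` two-level law; this file is the bond-level supplier of the line-composite
presentation only (owner R13: both presentations legitimate at model level; B7's B3 slot takes either BY NAME).

HONEST FRAMING (T4-DAG p. 1).  Model level (bond variables as DATA, global small field, regular gauge as a hypothesis shape); finite torus,
linear layer, operator norm; contours OURS ((1.7)/(1.18)/(9) are SHAPE locators); rates / pairings / constants OURS; NOT [B7] (124) or [B9]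
(3.15)/(3.26) as printed; ROOT B stays CONDITIONAL on NE3 (the `βb` budget) by name; NE2 NOT proved; NOT infinite volume / mass gap / Clay /
summit progress; spine 0/9 unchanged.  HONEST DEPENDENCY: continuum YM on T⁴ ⇐ BetaPertH ∧ nine spine estimates (0/9 proved); BetaPertH ⇐
(D1) ∧ (D4) ∧ CAP+tail; G-an2-4 gates asym, D1 and NE2/3/4.  ABSOLUTE RULE kept; no `sorry`.
-/

noncomputable section

open scoped BigOperators ComplexConjugate Matrix Matrix.Norms.L2Operator Kronecker

namespace Summit.QuantumFields.BalabanUV.T4Continuum.CovariantLineTransporters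

open Literature.MathematicalPhysics.QuantumFieldTheory.Balaban1983to89.B5Prop11Plancherel (fine Tor Cst Cst_nonneg)
open Literature.MathematicalPhysics.QuantumFieldTheory.Balaban1983to89.B5G183RateTorus (cpt)
open Literature.MathematicalPhysics.QuantumFieldTheory.Balaban1983to89.B5G183RateUnitTower (lev lev_neZero)
open Summit.QuantumFields.BalabanUV.T4Continuum
open Summit.QuantumFields.BalabanUV.T4Continuum.BalabanAveragedTowerUnit (idx Qlev QBlev)
open Summit.QuantumFields.BalabanUV.T4Continuum.BalabanAveragedTowerModes (par rem cpt_par_add_off_rem)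
open Summit.QuantumFields.BalabanUV.T4Continuum.BackgroundResolventLaw (l2_opNorm_one_le)
open Summit.QuantumFields.BalabanUV.T4Continuum.BackgroundResolventTower
open Summit.QuantumFields.BalabanUV.T4Continuum.KingPairingPlantedLaw
open Summit.QuantumFields.BalabanUV.T4Continuum.CovariantAveragingTower (TowerLimitRate)
open Summit.QuantumFields.BalabanUV.T4Continuum.KroneckerLift
open Summit.QuantumFields.BalabanUV.T4Continuum.GramPerturbationLaw
open Summit.QuantumFields.BalabanUV.T4Continuum.CompositeAveragingLaw
open Summit.QuantumFields.BalabanUV.T4Continuum.CovariantBlockAveraging (leg length_leg transport)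
open Summit.QuantumFields.BalabanUV.T4Continuum.CovariantLineAveragingTower

variable {d : ℕ}

/-! ## §1 Products of contractions along a list -/

section ListAlgebra

variable {β : Type*} {o : Type*} [Fintype o] [DecidableEq o]

/-- a product of contractions is a contraction (also the empty product, `‖1‖ ≤ 1`). [folklore] -/
theorem norm_prod_map_le_one (Γ : List β) (f : β → Matrix o o ℂ) (hf : ∀ b ∈ Γ, ‖f b‖ ≤ 1) : ‖(Γ.map f).prod‖ ≤ 1 := by
  induction Γ with
  | nil => simpa using (l2_opNorm_one_le (m := o))
  | cons b Γ ih =>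
    rw [List.map_cons, List.prod_cons]
    calc _ ≤ ‖f b‖ * ‖(Γ.map f).prod‖ := Matrix.l2_opNorm_mul _ _
      _ ≤ 1 * 1 := mul_le_mul (hf b List.mem_cons_self) (ih fun c hc => hf c (List.mem_cons_of_mem b hc)) (norm_nonneg _)
          zero_le_one
      _ = 1 := one_mul 1

/-- **TELESCOPING OF TWO PRODUCTS OF CONTRACTIONS** over the same bond list: `‖Π_b f b − Π_b g b‖ ≤ |Γ| · sup_b ‖f b − g b‖`
(`XP − YQ = (X − Y)P + Y(P − Q)`). [folklore] -/
theorem norm_prod_map_sub_prod_map_le (Γ : List β) (f g : β → Matrix o o ℂ) (hf : ∀ b ∈ Γ, ‖f b‖ ≤ 1) (hg : ∀ b ∈ Γ, ‖g b‖ ≤ 1)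
    {c : ℝ} (h : ∀ b ∈ Γ, ‖f b - g b‖ ≤ c) : ‖(Γ.map f).prod - (Γ.map g).prod‖ ≤ Γ.length * c := by
  induction Γ with
  | nil => simp
  | cons b Γ ih =>
    have hf' : ∀ c ∈ Γ, ‖f c‖ ≤ 1 := fun c hc => hf c (List.mem_cons_of_mem b hc)
    have hg' : ∀ c ∈ Γ, ‖g c‖ ≤ 1 := fun c hc => hg c (List.mem_cons_of_mem b hc)
    have hΓ := ih hf' hg' fun c hc => h c (List.mem_cons_of_mem b hc)
    have hP : ‖(Γ.map f).prod‖ ≤ 1 := norm_prod_map_le_one Γ f hf'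
    have hc0 : 0 ≤ c := (norm_nonneg _).trans (h b List.mem_cons_self)
    rw [List.map_cons, List.map_cons, List.prod_cons, List.prod_cons, List.length_cons]
    have e : f b * (Γ.map f).prod - g b * (Γ.map g).prod
        = (f b - g b) * (Γ.map f).prod + g b * ((Γ.map f).prod - (Γ.map g).prod) := by noncomm_ring
    rw [e]
    calc ‖(f b - g b) * (Γ.map f).prod + g b * ((Γ.map f).prod - (Γ.map g).prod)‖
        ≤ ‖f b - g b‖ * ‖(Γ.map f).prod‖ + ‖g b‖ * ‖(Γ.map f).prod - (Γ.map g).prod‖ :=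
          (norm_add_le _ _).trans (add_le_add (Matrix.l2_opNorm_mul _ _) (Matrix.l2_opNorm_mul _ _))
      _ ≤ c * 1 + 1 * (Γ.length * c) :=
          add_le_add (mul_le_mul (h b List.mem_cons_self) hP (norm_nonneg _) hc0) (mul_le_mul (hg b List.mem_cons_self) hΓ
            (norm_nonneg _) zero_le_one)
      _ = ((Γ.length + 1 : ℕ) : ℝ) * c := by push_cast; ring

/-- the product of identities is the identity. [folklore] -/
theorem prod_map_one (Γ : List β) : (Γ.map fun _ => (1 : Matrix o o ℂ)).prod = 1 := by
  induction Γ with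
  | nil => rfl
  | cons b Γ ih => rw [List.map_cons, List.prod_cons, ih, Matrix.one_mul]

/-- **TELESCOPING AGAINST THE IDENTITY**: `‖Π_b f b − 1‖ ≤ |Γ| · sup_b ‖f b − 1‖` for contractions (LINEAR in the length; compare
`CovariantBlockAveraging.norm_listProd_sub_one_le`, `(1 + a)^{|Γ|} − 1` without the contraction hypothesis). [folklore] -/
theorem norm_prod_map_sub_one_le (Γ : List β) (f : β → Matrix o o ℂ) (hf : ∀ b ∈ Γ, ‖f b‖ ≤ 1) {a : ℝ}
    (h : ∀ b ∈ Γ, ‖f b - 1‖ ≤ a) : ‖(Γ.map f).prod - 1‖ ≤ Γ.length * a := by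
  have h1 := norm_prod_map_sub_prod_map_le Γ f (fun _ => 1) hf (fun _ _ => l2_opNorm_one_le) h
  rwa [prod_map_one] at h1

end ListAlgebra

/-! ## §2 The one-step block contour (two levels `(N, R)`) -/

section Contours

variable (N R : ℕ) [NeZero N] [NeZero R] (M : Fin d → ℕ) [hM : ∀ μ, NeZero (M μ)]

/-- the corner of the one-step block contour after the first `m` directions have been walked: `R·par z + (rem z₀, …, rem z_{m−1}, 0, …, 0)`.
[cite: Balaban1984PropagatorsI, (1.7) p.18 (shape)] [folklore] -/
def bcorner (z : Tor (fine (R * N) M)) (m : ℕ) : Tor (fine (R * N) M) :=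
  cpt N R M (par N R M z) + fun ν : Fin d => if (ν : ℕ) < m then (((rem N R M z ν : Fin R) : ℕ) : ZMod (fine (R * N) M ν)) else 0

/-- **THE ONE-STEP BLOCK CONTOUR** `Γ_{R·par z, z}`: `rem z₀` bonds in direction `0` from the block corner `R·par z`, then `rem z₁` bonds in
direction `1`, … («Γ_{y,x} = [y, (x₁, y₂, …, y_d)] ∪ … ∪ [(x₁, …, x_{d−1}, y_d), x]»). [cite: Balaban1984PropagatorsI, (1.7) p.18 (shape)]
[folklore] -/
def bcontour (z : Tor (fine (R * N) M)) : List (Tor (fine (R * N) M) × Fin d) :=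
  (List.finRange d).flatMap fun ν : Fin d => leg (R * N) M ν (bcorner N R M z (ν : ℕ)) ((rem N R M z ν : Fin R) : ℕ)

/-- the LAST corner is the site itself: `R·par z + rem z = z` (`BalabanAveragedTowerModes.cpt_par_add_off_rem`); leg `ν` runs from corner `ν`
to corner `ν + 1` (that endpoint bookkeeping is not needed below — only the LENGTH of the contour enters the laws). [folklore] -/
theorem bcorner_last (z : Tor (fine (R * N) M)) : bcorner N R M z d = z := by
  conv_rhs => rw [← cpt_par_add_off_rem N R M z]
  rw [bcorner]
  congr 1
  funext ν
  rw [if_pos ν.isLt]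
  rfl

omit [NeZero N] hM in
/-- the one-step block contour has at most `d·(R − 1)` bonds (`rem z ν ≤ R − 1`). [folklore] -/
theorem length_bcontour_le (z : Tor (fine (R * N) M)) : (bcontour N R M z).length ≤ d * (R - 1) := by
  rw [bcontour, List.length_flatMap]
  have h2 : ∀ x ∈ List.map (fun ν : Fin d => (leg (R * N) M ν (bcorner N R M z (ν : ℕ)) ((rem N R M z ν : Fin R) : ℕ)).length)
      (List.finRange d), x ≤ R - 1 := by
    intro x hx
    obtain ⟨ν, _, rfl⟩ := List.mem_map.mp hx
    rw [length_leg]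
    exact Nat.le_sub_one_of_lt (rem N R M z ν).isLt
  have h3 := List.sum_le_card_nsmul _ (R - 1) h2
  rw [List.length_map, List.length_finRange, smul_eq_mul] at h3
  exact h3

end Contours

/-! ## §3 The transporters from a per-bond tower -/

section Transporters

variable (L : ℕ) [NeZero L] (M : Fin d → ℕ) [hM : ∀ μ, NeZero (M μ)] {o : Type*} [Fintype o] [DecidableEq o]

/-- a ONE-STEP CONTOUR SYSTEM along the tower: at step `j`, for every fine 1-form index `x` of the `L^{−(j+1)}` lattice, the bond list along
which `x` is transported to the base point of its `L`-block (DATA; canonical instance `stepContour`). [folklore] -/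
abbrev StepContours (L : ℕ) (M : Fin d → ℕ) : Type := (j : ℕ) → idx L M (j + 1) → List (idx L M (j + 1))

/-- the canonical one-step contour system: the (1.7) block contour of the SITE of `x` (independent of the component).
[cite: Balaban1984PropagatorsI, (1.7) p.18 (shape)] [folklore] -/
def stepContour : StepContours L M := fun j x => bcontour (lev L j) L M x.1

omit hM in
/-- the canonical contours have length `≤ d·(L − 1)` at every step. [folklore] -/
theorem length_stepContour_le (j : ℕ) (x : idx L M (j + 1)) : (stepContour L M j x).length ≤ d * (L - 1) :=
  length_bcontour_le (lev L j) L M x.1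

/-- the STRAIGHT LINE of `t` bonds in the own direction: `⟨x, x+e_μ⟩, …, ⟨x+(t−1)e_μ, x+te_μ⟩` for `x = (site, μ)` (the line «A([x, x(b)])»
of (1.18)). [cite: Balaban1984PropagatorsI, (1.18) p.20 (shape)] [folklore] -/
def lineBonds (j t : ℕ) (x : idx L M (j + 1)) : List (idx L M (j + 1)) := leg (L * lev L j) M x.2 x.1 t

omit [NeZero L] hM in
/-- the line of `t` bonds has `t` bonds. [folklore] -/
theorem length_lineBonds (j t : ℕ) (x : idx L M (j + 1)) : (lineBonds L M j t x).length = t :=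
  length_leg _ _ _ _ _

/-- **THE ONE-STEP BLOCK TRANSPORTERS FROM BONDS**: `T k j x = Π_{b ∈ Γ j x} U k j b` (ordered bond product, first bond leftmost).
[cite: Balaban1985Averaging, (9) p.18 (shape «U(Γ) = Π_i U(x_i, x_{i+1})»)] [folklore] -/
def Tb (Γ : StepContours L M) (U : ℕ → (j : ℕ) → idx L M (j + 1) → Matrix o o ℂ) (k j : ℕ) (x : idx L M (j + 1)) : Matrix o o ℂ :=
  ((Γ j x).map (U k j)).prod

/-- **THE LINE TRANSPORTERS FROM BONDS**: `Rl k j t x = Π_{s<t} U k j (x + s e_μ, μ)`. [cite: Balaban1984PropagatorsI, (1.18) p.20 (shape)]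
[folklore] -/
def Rlb (U : ℕ → (j : ℕ) → idx L M (j + 1) → Matrix o o ℂ) (k j : ℕ) (t : Fin L) (x : idx L M (j + 1)) : Matrix o o ℂ :=
  ((lineBonds L M j (t : ℕ) x).map (U k j)).prod

omit [NeZero L] hM in
/-- the block transporter IS leaf-07's `transport` of the bond field read in any colour slot. [folklore] -/
theorem Tb_eq_transport (Γ : StepContours L M) (U : ℕ → (j : ℕ) → idx L M (j + 1) → Matrix o o ℂ) (k j : ℕ) (x : idx L M (j + 1))
    (μ : Fin d) : Tb L M Γ U k j x = transport (fine (lev L (j + 1)) M) (fun ν i => U k j (i.1, ν)) μ (Γ j x) := rfl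

omit [NeZero L] hM in
/-- at `U = 1` the block transporters are trivial. [folklore] -/
theorem Tb_one (Γ : StepContours L M) : Tb L M Γ (fun _ _ _ => (1 : Matrix o o ℂ)) = fun _ _ _ => 1 := by
  funext k j x; exact prod_map_one _

omit [NeZero L] hM in
/-- at `U = 1` the line transporters are trivial. [folklore] -/
theorem Rlb_one : Rlb L M (fun _ _ _ => (1 : Matrix o o ℂ)) = fun _ _ _ _ => 1 := by
  funext k j t x; exact prod_map_one _

/-- **AT `U = 1` THE TYPED COVARIANT AVERAGING BUILT FROM BONDS IS BAŁABAN's `Q_k ⊗ 1`** (`Bref`; by construction, trigger c5 — no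
dictionary asserted). [folklore] -/
theorem QcovLine_bonds_one (Γ : StepContours L M) (k : ℕ) :
    QcovLine L M (Tb L M Γ (fun _ _ _ => (1 : Matrix o o ℂ))) (Rlb L M (fun _ _ _ => (1 : Matrix o o ℂ))) k = Bref L M k := by
  rw [Tb_one, Rlb_one]
  exact QcovLine_one_one L M k

/-- hence at `U = 1` the transport error built from bonds vanishes identically. [folklore] -/
theorem Eline_bonds_one (Γ : StepContours L M) (k : ℕ) :
    Eline L M (Tb L M Γ (fun _ _ _ => (1 : Matrix o o ℂ))) (Rlb L M (fun _ _ _ => (1 : Matrix o o ℂ))) k = 0 := by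
  rw [Eline_eq, QcovLine_bonds_one, sub_self]

end Transporters

/-! ## §4 Per-bond laws ⇒ `LineTransportLaws` -/

section Laws

variable (L : ℕ) [NeZero L] (M : Fin d → ℕ) [hM : ∀ μ, NeZero (M μ)] {o : Type*} [Fintype o] [DecidableEq o]

/-- **THE LAWS OF THE PER-BOND TOWER** (hypothesis SHAPE on data, asserted by nobody): contractions; per-bond size `αb × spacing`
(small field in a regular gauge — the TYPE of hypothesis of [Balaban1985BackgroundPropagators] (3.35)–(3.36) p.396, a SHAPE locator;
the statement is OURS and nothing printed is asserted); per-bond TWO-DEPTH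
consistency `βb k j` (node NE3's currency at bond granularity). [folklore] -/
structure BondTowerLaws (U : ℕ → (j : ℕ) → idx L M (j + 1) → Matrix o o ℂ) (αb : ℝ) (βb : ℕ → ℕ → ℝ) : Prop where
  /-- `αb ≥ 0`, `βb ≥ 0` -/
  nonneg : 0 ≤ αb ∧ ∀ k j, 0 ≤ βb k j
  /-- bond variables are contractions -/
  norm_le : ∀ k j b, ‖U k j b‖ ≤ 1
  /-- bond variables are within `αb × spacing` of the identity -/
  sub_one_le : ∀ k j b, ‖U k j b - 1‖ ≤ αb * ((L : ℝ)⁻¹) ^ (j + 1)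
  /-- two-depth consistency per bond (NE3 currency) -/
  consistent : ∀ k j b, ‖U (k + 1) j b - U k j b‖ ≤ βb k j

omit [NeZero L] hM in
/-- NON-VACUITY: the trivial tower `U = 1` obeys the laws with `αb = 0`, `βb = 0`. [folklore] -/
theorem bondTowerLaws_one : BondTowerLaws L M (fun _ _ _ => (1 : Matrix o o ℂ)) 0 (fun _ _ => 0) where
  nonneg := ⟨le_rfl, fun _ _ => le_rfl⟩
  norm_le := fun _ _ _ => l2_opNorm_one_le
  sub_one_le := fun _ _ _ => by rw [sub_self, norm_zero, zero_mul]
  consistent := fun _ _ _ => by rw [sub_self, norm_zero]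

variable {Γ : StepContours L M} {ℓ : ℕ} {U : ℕ → (j : ℕ) → idx L M (j + 1) → Matrix o o ℂ} {αb : ℝ} {βb : ℕ → ℕ → ℝ}

omit hM in
/-- **PER-BOND LAWS ⇒ `LineTransportLaws`** for the transporters built from bonds along any one-step contour system of length `≤ ℓ`:
`αT = ℓ·αb·L⁻¹`, `αR = αb`, `βs k j = (ℓ + L)·βb k j` (path length × per-bond bound, telescoping of contractions). [folklore] -/
theorem lineTransportLaws_of_bonds (hΓ : ∀ j x, (Γ j x).length ≤ ℓ) (h : BondTowerLaws L M U αb βb) :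
    LineTransportLaws L M (Tb L M Γ U) (Rlb L M U) (ℓ * αb * (L : ℝ)⁻¹) αb (fun k j => (ℓ + L) * βb k j) := by
  have hL0 : (0 : ℝ) < L := by exact_mod_cast Nat.pos_of_ne_zero (NeZero.ne L)
  have hρ : ∀ j : ℕ, 0 ≤ αb * ((L : ℝ)⁻¹) ^ (j + 1) := fun j => mul_nonneg h.nonneg.1 (pow_nonneg (inv_nonneg.mpr hL0.le) _)
  have hlen : ∀ j x, ((Γ j x).length : ℝ) ≤ ℓ := fun j x => by exact_mod_cast hΓ j x
  refine ⟨⟨?_, h.nonneg.1, fun k j => ?_⟩, ?_, ?_, ?_, ?_, ?_, ?_⟩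
  · exact mul_nonneg (mul_nonneg (Nat.cast_nonneg ℓ) h.nonneg.1) (inv_nonneg.mpr hL0.le)
  · exact mul_nonneg (by positivity) (h.nonneg.2 k j)
  · exact fun k j x => norm_prod_map_le_one _ _ fun b _ => h.norm_le k j b
  · exact fun k j t x => norm_prod_map_le_one _ _ fun b _ => h.norm_le k j b
  · intro k j x
    refine (norm_prod_map_sub_one_le (Γ j x) (U k j) (fun b _ => h.norm_le k j b) fun b _ => h.sub_one_le k j b).trans ?_
    calc ((Γ j x).length : ℝ) * (αb * ((L : ℝ)⁻¹) ^ (j + 1)) ≤ ℓ * (αb * ((L : ℝ)⁻¹) ^ (j + 1)) :=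
          mul_le_mul_of_nonneg_right (hlen j x) (hρ j)
      _ = ℓ * αb * (L : ℝ)⁻¹ * ((L : ℝ)⁻¹) ^ j := by rw [pow_succ]; ring
  · intro k j t x
    have h1 := norm_prod_map_sub_one_le (lineBonds L M j (t : ℕ) x) (U k j) (fun b _ => h.norm_le k j b) fun b _ => h.sub_one_le k j b
    rw [length_lineBonds] at h1
    refine h1.trans ?_
    have ht : ((t : ℕ) : ℝ) ≤ L := by exact_mod_cast t.isLt.le
    calc ((t : ℕ) : ℝ) * (αb * ((L : ℝ)⁻¹) ^ (j + 1)) ≤ L * (αb * ((L : ℝ)⁻¹) ^ (j + 1)) := mul_le_mul_of_nonneg_right ht (hρ j)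
      _ = αb * ((L : ℝ)⁻¹) ^ j * ((L : ℝ) * (L : ℝ)⁻¹) := by rw [pow_succ]; ring
      _ = αb * ((L : ℝ)⁻¹) ^ j := by rw [mul_inv_cancel₀ hL0.ne', mul_one]
  · intro k j x
    refine (norm_prod_map_sub_prod_map_le (Γ j x) (U (k + 1) j) (U k j) (fun b _ => h.norm_le (k + 1) j b)
      (fun b _ => h.norm_le k j b) fun b _ => h.consistent k j b).trans ?_
    exact mul_le_mul_of_nonneg_right ((hlen j x).trans (le_add_of_nonneg_right hL0.le)) (h.nonneg.2 k j)
  · intro k j t x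
    have h1 := norm_prod_map_sub_prod_map_le (lineBonds L M j (t : ℕ) x) (U (k + 1) j) (U k j) (fun b _ => h.norm_le (k + 1) j b)
      (fun b _ => h.norm_le k j b) fun b _ => h.consistent k j b
    rw [length_lineBonds] at h1
    refine h1.trans (mul_le_mul_of_nonneg_right ?_ (h.nonneg.2 k j))
    have ht : ((t : ℕ) : ℝ) ≤ L := by exact_mod_cast t.isLt.le
    exact ht.trans (le_add_of_nonneg_left (Nat.cast_nonneg ℓ))

omit hM in
/-- the canonical-contour instance: `αT = d(L − 1)·αb·L⁻¹`, `αR = αb`, `βs = (d(L − 1) + L)·βb` (the §5 ENDs specialise the same way,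
with `hΓ := length_stepContour_le L M`). [folklore] -/
theorem lineTransportLaws_of_bonds_step (h : BondTowerLaws L M U αb βb) :
    LineTransportLaws L M (Tb L M (stepContour L M) U) (Rlb L M U) (((d * (L - 1) : ℕ) : ℝ) * αb * (L : ℝ)⁻¹) αb
      (fun k j => (((d * (L - 1) : ℕ) : ℝ) + L) * βb k j) :=
  lineTransportLaws_of_bonds L M (length_stepContour_le L M) h

end Laws

/-! ## §5 The ENDs of row B3.a-vec on per-bond data -/

section Ends

variable (L : ℕ) [NeZero L] (M : Fin d → ℕ) [hM : ∀ μ, NeZero (M μ)] (a : ℝ) (ha : 0 < a) {o : Type*} [Fintype o] [DecidableEq o]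
variable {Γ : StepContours L M} {ℓ : ℕ} {U : ℕ → (j : ℕ) → idx L M (j + 1) → Matrix o o ℂ} {αb : ℝ} {βb : ℕ → ℕ → ℝ}

/-- **`AveragingLaws` FOR THE TRANSPORT ERROR, FROM PER-BOND LAWS** (`L ≥ 2`): size `epsComp (ℓαbL⁻¹ + αb) L⁻¹`, sandwiched pairings
`deltaComp Cst (ℓαbL⁻¹ + αb) L⁻¹ (dLCst·L^{−k}) (Σ_{j<k} 2(ℓ + L)βb k j)`. [cite: Balaban1984PropagatorsI, (1.18) p.20, Prop. 1.1 (1.89) p.33;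
Balaban1985Averaging, (125) p.36 (shape)] [folklore] -/
theorem averagingLaws_covariantLine_of_bonds (hL : 2 ≤ L) (hΓ : ∀ j x, (Γ j x).length ≤ ℓ) (h : BondTowerLaws L M U αb βb) :
    AveragingLaws (fun k => calDalev L M a ha k ⊗ₖ (1 : Matrix o o ℂ)) (Eline L M (Tb L M Γ U) (Rlb L M U))
      (fun k => JpcT L M k ⊗ₖ (1 : Matrix o o ℂ)) (epsComp (ℓ * αb * (L : ℝ)⁻¹ + αb) ((L : ℝ)⁻¹))
      (deltaComp (Cst d a) (ℓ * αb * (L : ℝ)⁻¹ + αb) ((L : ℝ)⁻¹) (fun k => d * L * Cst d a * ((L : ℝ)⁻¹) ^ k)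
        (fun k => ∑ j ∈ Finset.range k, 2 * ((ℓ + L) * βb k j))) :=
  averagingLaws_covariantLine L M a ha hL (lineTransportLaws_of_bonds L M hΓ h)

/-- **THE GRAM ROW OF `Δ_a(U)` FOR THE `Q` INSIDE `Δ_a`, FROM PER-BOND LAWS** — THE ONE TARGET SHAPE `PerturbationLaws (Δ_a ⊗ 1)
(c·((Q^U)ᴴQ^U − QᴴQ)) (J ⊗ 1) κ_Q e₂`; CONDITIONAL content = the `βb` budget (NE3) only. [cite: Balaban1985BackgroundPropagators, (3.26) p.395
(where `Q*(U)aQ(U)` enters); Balaban1984PropagatorsI, (1.69) p.29, Prop. 1.1 (1.89) p.33] [folklore] -/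
theorem perturbationLaws_covariantLineGram_of_bonds (hL : 2 ≤ L) (hΓ : ∀ j x, (Γ j x).length ≤ ℓ) (h : BondTowerLaws L M U αb βb)
    (c : ℂ) :
    PerturbationLaws (fun k => calDalev L M a ha k ⊗ₖ (1 : Matrix o o ℂ)) (gramPert c (Bref L M) (Eline L M (Tb L M Γ U) (Rlb L M U)))
      (fun k => JpcT L M k ⊗ₖ (1 : Matrix o o ℂ)) (kappaLine d L a (ℓ * αb * (L : ℝ)⁻¹) αb c)
      (fun k => ‖c‖ * e2gram (Cst d a) 1 (epsComp (ℓ * αb * (L : ℝ)⁻¹ + αb) ((L : ℝ)⁻¹)) (fun k => 2 * d * Cst d a * ((L : ℝ)⁻¹) ^ k)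
        (fun k => CJ d a * ((L : ℝ)⁻¹) ^ k) (fun k => d * L * Cst d a * ((L : ℝ)⁻¹) ^ k)
        (deltaComp (Cst d a) (ℓ * αb * (L : ℝ)⁻¹ + αb) ((L : ℝ)⁻¹) (fun k => d * L * Cst d a * ((L : ℝ)⁻¹) ^ k)
          (fun k => ∑ j ∈ Finset.range k, 2 * ((ℓ + L) * βb k j))) k) :=
  perturbationLaws_covariantLineGram L M a ha hL (lineTransportLaws_of_bonds L M hΓ h) c

/-- **η-RATE FROM PER-BOND LAWS** (`L ≥ 2`, geometric consistency budget `Σ_{j<k} 2(ℓ + L)βb k j ≤ Ccs·L^{−k}`, `‖t‖κ_Q < 1`): the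
King-averaged unit-lattice covariances of `(Δ_a^{(k)} ⊗ 1 + t·c·((Q^U_k)ᴴQ^U_k − Q_kᴴQ_k))⁻¹` converge with rate `L^{−k}`.
[cite: King1986, Lemma 4.5 (4.32)/(4.38) p.674 (scalar template); Balaban1985BackgroundPropagators, (3.26) p.395] [folklore] -/
theorem towerLimitRate_covariantLineGram_of_bonds (hL : 2 ≤ L) (hΓ : ∀ j x, (Γ j x).length ≤ ℓ) (h : BondTowerLaws L M U αb βb) {Ccs : ℝ}
    (hcs : ∀ k, ∑ j ∈ Finset.range k, 2 * ((ℓ + L) * βb k j) ≤ Ccs * ((L : ℝ)⁻¹) ^ k) (c : ℂ) {t : ℂ}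
    (ht : ‖t‖ * kappaLine d L a (ℓ * αb * (L : ℝ)⁻¹) αb c < 1) :
    TowerLimitRate (fun k => Qlev L M k ⊗ₖ (1 : Matrix o o ℂ)) ((L : ℝ) ^ d)
      (fun k => (calDalev L M a ha k ⊗ₖ (1 : Matrix o o ℂ) + t • gramPert c (Bref L M) (Eline L M (Tb L M Γ U) (Rlb L M U)) k)⁻¹)
      (Cpert (kappaLine d L a (ℓ * αb * (L : ℝ)⁻¹) αb c) (2 * d * Cst d a) (CJ d a) (C2line d L a (ℓ * αb * (L : ℝ)⁻¹) αb Ccs c) 0 t)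
      ((L : ℝ)⁻¹) :=
  towerLimitRate_covariantLineGram L M a ha hL (lineTransportLaws_of_bonds L M hΓ h) hcs c ht

/-- **THE PHYSICAL VALUE FROM PER-BOND LAWS**: `t = 1`, `c = a`, small-field regime `κ_Q(a) < 1` DISPLAYED. [folklore] -/
theorem covariantLineGram_rate_of_bonds (hL : 2 ≤ L) (hΓ : ∀ j x, (Γ j x).length ≤ ℓ) (h : BondTowerLaws L M U αb βb) {Ccs : ℝ}
    (hcs : ∀ k, ∑ j ∈ Finset.range k, 2 * ((ℓ + L) * βb k j) ≤ Ccs * ((L : ℝ)⁻¹) ^ k)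
    (hsmall : kappaLine d L a (ℓ * αb * (L : ℝ)⁻¹) αb (a : ℂ) < 1) :
    TowerLimitRate (fun k => Qlev L M k ⊗ₖ (1 : Matrix o o ℂ)) ((L : ℝ) ^ d)
      (fun k => (calDalev L M a ha k ⊗ₖ (1 : Matrix o o ℂ) + gramPert (a : ℂ) (Bref L M) (Eline L M (Tb L M Γ U) (Rlb L M U)) k)⁻¹)
      (Cpert (kappaLine d L a (ℓ * αb * (L : ℝ)⁻¹) αb (a : ℂ)) (2 * d * Cst d a) (CJ d a)
        (C2line d L a (ℓ * αb * (L : ℝ)⁻¹) αb Ccs (a : ℂ)) 0 1) ((L : ℝ)⁻¹) :=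
  covariantLineGram_rate L M a ha hL (lineTransportLaws_of_bonds L M hΓ h) hcs hsmall

/-! ## §6 Where node NE3 enters: the depth-independent reading carries no consistency budget -/

omit [NeZero L] hM in
/-- **DEPTH-INDEPENDENT READING**: if the step-`j` backgrounds of every depth are read from ONE level tower `W` (`U k j := W (j+1)`), the
per-bond laws hold with consistency budget `0`.  (NOT Bałaban's `U_k(V)`: its `j`-fold averages depend on the depth `k` — that dependence is
exactly where node NE3 enters the line presentation.) [folklore] -/
theorem bondTowerLaws_of_levels {W : (n : ℕ) → idx L M n → Matrix o o ℂ} {αb : ℝ} (hα : 0 ≤ αb) (hW1 : ∀ n b, ‖W n b‖ ≤ 1)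
    (hW : ∀ n b, ‖W n b - 1‖ ≤ αb * ((L : ℝ)⁻¹) ^ n) :
    BondTowerLaws L M (fun _ j => W (j + 1)) αb (fun _ _ => 0) where
  nonneg := ⟨hα, fun _ _ => le_rfl⟩
  norm_le := fun _ j b => hW1 (j + 1) b
  sub_one_le := fun _ j b => hW (j + 1) b
  consistent := fun _ j b => by rw [sub_self, norm_zero]

/-- the η-rate in the depth-independent reading: NO consistency budget (`Ccs = 0`), threshold on `αb` alone. [folklore] -/
theorem covariantLineGram_rate_of_levels (hL : 2 ≤ L) (hΓ : ∀ j x, (Γ j x).length ≤ ℓ) {W : (n : ℕ) → idx L M n → Matrix o o ℂ}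
    {αb : ℝ} (hα : 0 ≤ αb) (hW1 : ∀ n b, ‖W n b‖ ≤ 1) (hW : ∀ n b, ‖W n b - 1‖ ≤ αb * ((L : ℝ)⁻¹) ^ n)
    (hsmall : kappaLine d L a (ℓ * αb * (L : ℝ)⁻¹) αb (a : ℂ) < 1) :
    TowerLimitRate (fun k => Qlev L M k ⊗ₖ (1 : Matrix o o ℂ)) ((L : ℝ) ^ d)
      (fun k => (calDalev L M a ha k ⊗ₖ (1 : Matrix o o ℂ)
        + gramPert (a : ℂ) (Bref L M) (Eline L M (Tb L M Γ (fun _ j => W (j + 1))) (Rlb L M (fun _ j => W (j + 1)))) k)⁻¹)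
      (Cpert (kappaLine d L a (ℓ * αb * (L : ℝ)⁻¹) αb (a : ℂ)) (2 * d * Cst d a) (CJ d a)
        (C2line d L a (ℓ * αb * (L : ℝ)⁻¹) αb 0 (a : ℂ)) 0 1) ((L : ℝ)⁻¹) :=
  covariantLineGram_rate_of_bonds L M a ha hL hΓ (bondTowerLaws_of_levels L M hα hW1 hW) (fun k => by simp) hsmall

end Ends

end Summit.QuantumFields.BalabanUV.T4Continuum.CovariantLineTransporters

end
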